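import Mathlib
import Literature.Analysis.FluidPDE.VectorCalculus
import Literature.Analysis.FluidPDE.LeiZhang2011Proofs
import Summits.NavierStokesRegularity.NavierStokesRegularity.Theorems.FilamentSkeletonRssSelectionBoxRJRungBending

/-!
# Route `FilamentSkeletonRss` · crux `SelectionBoxRJ` (stmt-NavierStokesRegularity-21220) — rung tools (R2, brick 4b):
# stability of the cut-off local-induction arc under a change of the forcing

Lane `ns-filament-19175-p1` (g7); helper file `--supports stmt-NavierStokesRegularity-21220`, route-independent.

The contraction estimate of the nonlocal rung's Picard map needs: two `C²` unit-speed solutions `x₁, x₂` of the cut-off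
equation `x″ = c(t) • x′ × (V(x) + fᵢ(t))` (`V y = ½ y − (21/5) e₃ × y`, `|c| ≤ η`, `c = 0` beyond `S₂`) with the SAME
Cauchy data differ in tangent by at most `2 η S₂ · sup_{|t| ≤ S₂} ‖f₁ − f₂‖` on all of `ℝ`, provided the window is short in
the natural units: `η S₂ ((47/10)(‖x₁ 0‖ + 2 S₂) + M) ≤ ½` (`M` a bound for `f₁` on the window).  This is
`cutoff_tangent_stability`.  The proof is a sup/bootstrap argument (no exponential Grönwall factor): with
`E = max_{|t| ≤ S₂} ‖x₁′ − x₂′‖`, positions differ by `≤ S₂ E`, so `‖(x₁′ − x₂′)′‖ ≤ η(aE + ε)` on the window and the mean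
value inequality gives `E ≤ η S₂ (aE + ε)`.  In the rung's scaling `η S₂ a = O(Rb²)` uniformly in `Γ`
(`…RungModelArcConstants.rung_constants`).

HONEST FRAMING.  ODE bookkeeping for the rung ladder of a HYPOTHETICAL filament box; nothing here is a claim about
Navier–Stokes regularity or blow-up.
-/

set_option linter.dupNamespace false -- `Theorems.…Theorems`-style path/namespace repetition is the tree convention

noncomputable section

namespace Summit.NavierStokesRegularity.NavierStokesRegularity.Theorems

open Set Function Filter Real
open Literature.Analysis.FluidPDE
open scoped InnerProductSpace Topology

namespace SelectionBoxRJRung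

/-- **Tangent stability of the cut-off local-induction arc under a change of forcing.**  See the module docstring.
[folklore] -/
theorem cutoff_tangent_stability {η S₂ M ε : ℝ} {c : ℝ → ℝ} {f₁ f₂ x₁ x₂ : ℝ → EuclideanSpace ℝ (Fin 3)}
    (hη : 0 ≤ η) (hS₂ : 0 < S₂) (hM : 0 ≤ M) (hε : 0 ≤ ε)
    (hx₁ : ContDiff ℝ 2 x₁) (hx₂ : ContDiff ℝ 2 x₂) (hunit₁ : ∀ t, ‖deriv x₁ t‖ = 1) (hunit₂ : ∀ t, ‖deriv x₂ t‖ = 1)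
    (h0 : x₁ 0 = x₂ 0) (h0' : deriv x₁ 0 = deriv x₂ 0)
    (hode₁ : ∀ t, iteratedDeriv 2 x₁ t = c t • cross (deriv x₁ t)
      ((1 / 2 : ℝ) • x₁ t - (21 / 5 : ℝ) • cross (EuclideanSpace.single 2 1) (x₁ t) + f₁ t))
    (hode₂ : ∀ t, iteratedDeriv 2 x₂ t = c t • cross (deriv x₂ t)
      ((1 / 2 : ℝ) • x₂ t - (21 / 5 : ℝ) • cross (EuclideanSpace.single 2 1) (x₂ t) + f₂ t))
    (hc : ∀ t, |c t| ≤ η) (hc0 : ∀ t, S₂ ≤ |t| → c t = 0)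
    (hf₁ : ∀ t, |t| ≤ S₂ → ‖f₁ t‖ ≤ M) (hdf : ∀ t, |t| ≤ S₂ → ‖f₁ t - f₂ t‖ ≤ ε)
    (hsmall : η * S₂ * ((47 / 10) * (‖x₁ 0‖ + 2 * S₂) + M) ≤ 1 / 2) :
    ∀ t, ‖deriv x₁ t - deriv x₂ t‖ ≤ 2 * η * S₂ * ε := by
  have hx₁d : Differentiable ℝ x₁ := hx₁.differentiable (by norm_num)
  have hx₂d : Differentiable ℝ x₂ := hx₂.differentiable (by norm_num)
  have hT₁d : Differentiable ℝ (deriv x₁) := hx₁.differentiable_deriv_two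
  have hT₂d : Differentiable ℝ (deriv x₂) := hx₂.differentiable_deriv_two
  have h2₁ : iteratedDeriv 2 x₁ = deriv (deriv x₁) := by rw [iteratedDeriv_succ, iteratedDeriv_one]
  have h2₂ : iteratedDeriv 2 x₂ = deriv (deriv x₂) := by rw [iteratedDeriv_succ, iteratedDeriv_one]
  -- the drift as a continuous linear map
  set A : EuclideanSpace ℝ (Fin 3) →L[ℝ] EuclideanSpace ℝ (Fin 3) :=
    (1 / 2 : ℝ) • ContinuousLinearMap.id ℝ (EuclideanSpace ℝ (Fin 3)) -
      (21 / 5 : ℝ) • crossCLM (EuclideanSpace.single (2 : Fin 3) (1 : ℝ)) with hAdef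
  have hA : ∀ y, A y = (1 / 2 : ℝ) • y - (21 / 5 : ℝ) • cross (EuclideanSpace.single (2 : Fin 3) (1 : ℝ)) y :=
    fun y => by simp [hAdef]
  have hAn : ∀ y, ‖A y‖ ≤ 47 / 10 * ‖y‖ := fun y => by
    rw [hA]; have := norm_drift_le (21 / 5 : ℝ) y; norm_num at this; linarith
  -- the differences
  set D : ℝ → EuclideanSpace ℝ (Fin 3) := fun t => deriv x₁ t - deriv x₂ t with hDdef
  set Δ : ℝ → EuclideanSpace ℝ (Fin 3) := fun t => x₁ t - x₂ t with hΔdef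
  have hΔd : ∀ t, HasDerivAt Δ (D t) t := fun t => ((hx₁d t).hasDerivAt).sub ((hx₂d t).hasDerivAt)
  have hDd : ∀ t, HasDerivAt D (deriv (deriv x₁) t - deriv (deriv x₂) t) t := fun t =>
    ((hT₁d t).hasDerivAt).sub ((hT₂d t).hasDerivAt)
  have hD0 : D 0 = 0 := by simp [hDdef, h0']
  have hΔ0 : Δ 0 = 0 := by simp [hΔdef, h0]
  have hDcont : Continuous D := continuous_iff_continuousAt.2 fun t => (hDd t).continuousAt
  -- the maximum of `‖D‖` on the window
  obtain ⟨t₀, ht₀, hmax⟩ := (isCompact_Icc : IsCompact (Icc (-S₂) S₂)).exists_isMaxOn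
    (nonempty_Icc.2 (by linarith)) (hDcont.norm.continuousOn)
  set E : ℝ := ‖D t₀‖ with hEdef
  have hE0 : 0 ≤ E := norm_nonneg _
  have hEmax : ∀ t ∈ Icc (-S₂) S₂, ‖D t‖ ≤ E := fun t ht => hmax ht
  -- positions on the window
  have hpos : ∀ s ∈ Icc (-S₂) S₂, ‖x₁ s‖ ≤ ‖x₁ 0‖ + S₂ := fun s hs => by
    have h := liaModel_position_bound hx₁d hunit₁ s
    have : |s| ≤ S₂ := abs_le.2 ⟨hs.1, hs.2⟩
    linarith
  have hΔle : ∀ s ∈ Icc (-S₂) S₂, ‖Δ s‖ ≤ E * S₂ := by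
    intro s hs
    have h := Convex.norm_image_sub_le_of_norm_deriv_le (f := Δ) (s := Icc (-S₂) S₂) (C := E)
      (fun v _ => (hΔd v).differentiableAt) (fun v hv => by rw [(hΔd v).deriv]; exact hEmax v hv)
      (convex_Icc _ _) (show (0:ℝ) ∈ Icc (-S₂) S₂ from ⟨by linarith, by linarith⟩) hs
    rw [hΔ0, sub_zero, sub_zero, Real.norm_eq_abs] at h
    have : |s| ≤ S₂ := abs_le.2 ⟨hs.1, hs.2⟩
    nlinarith
  -- the derivative of `D` on the window
  set a : ℝ := (47 / 10) * (‖x₁ 0‖ + S₂) + M + (47 / 10) * S₂ with hadef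
  have hD'le : ∀ s ∈ Icc (-S₂) S₂, ‖deriv D s‖ ≤ η * (a * E + ε) := by
    intro s hs
    have hs' : |s| ≤ S₂ := abs_le.2 ⟨hs.1, hs.2⟩
    rw [(hDd s).deriv, ← h2₁, ← h2₂, hode₁ s, hode₂ s, ← hA, ← hA]
    -- `x₁′ × (A x₁ + f₁) − x₂′ × (A x₂ + f₂) = D × (A x₁ + f₁) + x₂′ × (A Δ + (f₁ − f₂))`
    have hcsub : ∀ a b v : EuclideanSpace ℝ (Fin 3), cross (a - b) v = cross a v - cross b v := fun a b v => by
      rw [← crossCLM_apply, ← crossCLM_apply, ← crossCLM_apply, map_sub]; rfl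
    have hcsub2 : ∀ a v w : EuclideanSpace ℝ (Fin 3), cross a (v - w) = cross a v - cross a w := fun a v w => by
      rw [← crossCLM_apply, ← crossCLM_apply, ← crossCLM_apply, map_sub]
    have hsplit : c s • cross (deriv x₁ s) (A (x₁ s) + f₁ s) - c s • cross (deriv x₂ s) (A (x₂ s) + f₂ s) =
        c s • (cross (D s) (A (x₁ s) + f₁ s) + cross (deriv x₂ s) (A (Δ s) + (f₁ s - f₂ s))) := by
      rw [← smul_sub]
      congr 1
      have e1 : A (Δ s) + (f₁ s - f₂ s) = (A (x₁ s) + f₁ s) - (A (x₂ s) + f₂ s) := by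
        rw [show Δ s = x₁ s - x₂ s from rfl, map_sub]; abel
      rw [e1, hcsub2, show D s = deriv x₁ s - deriv x₂ s from rfl, hcsub]
      abel
    rw [hsplit, norm_smul, Real.norm_eq_abs]
    have h1 : ‖cross (D s) (A (x₁ s) + f₁ s)‖ ≤ E * (47 / 10 * (‖x₁ 0‖ + S₂) + M) := by
      calc ‖cross (D s) (A (x₁ s) + f₁ s)‖ ≤ ‖D s‖ * ‖A (x₁ s) + f₁ s‖ := norm_cross_le_norm_mul_norm _ _
        _ ≤ E * (47 / 10 * (‖x₁ 0‖ + S₂) + M) := by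
            refine mul_le_mul (hEmax s hs) ?_ (norm_nonneg _) hE0
            calc ‖A (x₁ s) + f₁ s‖ ≤ ‖A (x₁ s)‖ + ‖f₁ s‖ := norm_add_le _ _
              _ ≤ 47 / 10 * ‖x₁ s‖ + M := add_le_add (hAn _) (hf₁ s hs')
              _ ≤ 47 / 10 * (‖x₁ 0‖ + S₂) + M := by nlinarith [hpos s hs]
    have h2 : ‖cross (deriv x₂ s) (A (Δ s) + (f₁ s - f₂ s))‖ ≤ 47 / 10 * (E * S₂) + ε := by
      calc ‖cross (deriv x₂ s) (A (Δ s) + (f₁ s - f₂ s))‖ ≤ ‖deriv x₂ s‖ * ‖A (Δ s) + (f₁ s - f₂ s)‖ :=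
            norm_cross_le_norm_mul_norm _ _
        _ = ‖A (Δ s) + (f₁ s - f₂ s)‖ := by rw [hunit₂ s, one_mul]
        _ ≤ ‖A (Δ s)‖ + ‖f₁ s - f₂ s‖ := norm_add_le _ _
        _ ≤ 47 / 10 * (E * S₂) + ε := add_le_add ((hAn _).trans (by nlinarith [hΔle s hs])) (hdf s hs')
    calc |c s| * ‖cross (D s) (A (x₁ s) + f₁ s) + cross (deriv x₂ s) (A (Δ s) + (f₁ s - f₂ s))‖
        ≤ η * (E * (47 / 10 * (‖x₁ 0‖ + S₂) + M) + (47 / 10 * (E * S₂) + ε)) :=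
          mul_le_mul (hc s) ((norm_add_le _ _).trans (add_le_add h1 h2)) (norm_nonneg _) hη
      _ = η * (a * E + ε) := by rw [hadef]; ring
  -- the bootstrap: `E ≤ η S₂ (a E + ε)`
  have hEle : E ≤ η * S₂ * (a * E + ε) := by
    have h := Convex.norm_image_sub_le_of_norm_deriv_le (f := D) (s := Icc (-S₂) S₂) (C := η * (a * E + ε))
      (fun v _ => (hDd v).differentiableAt) hD'le (convex_Icc _ _)
      (show (0:ℝ) ∈ Icc (-S₂) S₂ from ⟨by linarith, by linarith⟩) ht₀
    rw [hD0, sub_zero, sub_zero, Real.norm_eq_abs] at h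
    have : |t₀| ≤ S₂ := abs_le.2 ⟨ht₀.1, ht₀.2⟩
    have hK : 0 ≤ η * (a * E + ε) := by positivity
    calc E = ‖D t₀‖ := rfl
      _ ≤ η * (a * E + ε) * |t₀| := h
      _ ≤ η * (a * E + ε) * S₂ := mul_le_mul_of_nonneg_left this hK
      _ = η * S₂ * (a * E + ε) := by ring
  have ha : η * S₂ * a ≤ 1 / 2 := by
    have : a = (47 / 10) * (‖x₁ 0‖ + 2 * S₂) + M := by rw [hadef]; ring
    rw [this]; exact hsmall
  have hEfin : E ≤ 2 * η * S₂ * ε := by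
    have h1 : E * (1 - η * S₂ * a) ≤ η * S₂ * ε := by nlinarith [hEle]
    nlinarith [h1, hE0, mul_nonneg (mul_nonneg hη hS₂.le) hε]
  -- conclusion on the window and beyond it (`D` is constant beyond `S₂`)
  have hin : ∀ t, |t| ≤ S₂ → ‖deriv x₁ t - deriv x₂ t‖ ≤ 2 * η * S₂ * ε := fun t ht =>
    (hEmax t (abs_le.1 ht |> fun h => ⟨h.1, h.2⟩)).trans hEfin
  have hD'zero : ∀ v, S₂ ≤ |v| → deriv D v = 0 := fun v hv => by
    rw [(hDd v).deriv, ← h2₁, ← h2₂, hode₁ v, hode₂ v, hc0 v hv, zero_smul, zero_smul, sub_zero]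
  intro t
  rcases le_or_gt |t| S₂ with ht | ht
  · exact hin t ht
  · rcases le_or_gt 0 t with ht0 | ht0
    · rw [abs_of_nonneg ht0] at ht
      have h := Convex.norm_image_sub_le_of_norm_deriv_le (f := D) (s := Ici S₂) (C := 0)
        (fun v _ => (hDd v).differentiableAt)
        (fun v hv => by rw [hD'zero v (by rw [abs_of_nonneg (hS₂.le.trans hv)]; exact hv), norm_zero])
        (convex_Ici _) (mem_Ici.2 le_rfl) (mem_Ici.2 ht.le)
      rw [zero_mul, norm_le_zero_iff, sub_eq_zero] at h
      have hS : ‖deriv x₁ S₂ - deriv x₂ S₂‖ ≤ 2 * η * S₂ * ε := hin S₂ (by rw [abs_of_pos hS₂])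
      have hDt : D t = D S₂ := h
      simp only [hDdef] at hDt
      rw [hDt]; exact hS
    · rw [abs_of_neg ht0] at ht
      have h := Convex.norm_image_sub_le_of_norm_deriv_le (f := D) (s := Iic (-S₂)) (C := 0)
        (fun v _ => (hDd v).differentiableAt)
        (fun v hv => by
          have hvle := mem_Iic.1 hv
          rw [hD'zero v (by rw [abs_of_nonpos (by linarith)]; linarith), norm_zero])
        (convex_Iic _) (mem_Iic.2 le_rfl) (mem_Iic.2 (by linarith [ht] : t ≤ -S₂))
      rw [zero_mul, norm_le_zero_iff, sub_eq_zero] at h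
      have hS : ‖deriv x₁ (-S₂) - deriv x₂ (-S₂)‖ ≤ 2 * η * S₂ * ε := hin (-S₂) (by rw [abs_neg, abs_of_pos hS₂])
      have hDt : D t = D (-S₂) := h
      simp only [hDdef] at hDt
      rw [hDt]; exact hS

end SelectionBoxRJRung

end Summit.NavierStokesRegularity.NavierStokesRegularity.Theorems
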